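import Summits.Ventures.Crystal3D.Theorems.StickyWulffConstantNoReconstructionGainThirdLatticeCoverA
import Mathlib.Analysis.InnerProductSpace.Projection.Reflection
import Mathlib.GroupTheory.Perm.Sign
import Mathlib.Data.Fin.Tuple.Sort
import HarnessLib

/-!
# The cube group on the four `{111}` families, II: every permutation, sorting the normal

HONEST FRAMING. Part of the venture `Summits/Ventures/Crystal3D` (cell `crystal3d-full`), helper
`--supports` the crux `NoReconstructionGain` (stmt-Ventures-19144, route
`route-Ventures-StickyWulffConstant`), line `adhesion`; second half of the covering lemma (part I:
`…ThirdLatticeCoverA`).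

By swap induction over `S₄` every permutation of the four family normals `N_0..N_3` is realised, up
to a global sign removed with the central inversion, by a lattice isometry (a product of bond
half-turns); sorting the components `⟪N_f, ν⟫` decreasingly (`Tuple.sort`) puts any `ν` into the
fundamental cone `⟪N_0,ν⟫ ≥ ⟪N_1,ν⟫ ≥ ⟪N_2,ν⟫ ≥ ⟪N_3,ν⟫`, whose facets are `⟪h, ν⟫ ≤ 0` for the six
heads `h = (3/4)(N_b − N_a)` (`a < b`) of `fourFamilyBarlowFilm_slab`.

* `halfTurn_step` — the transposition step, uniform in `a ≠ b : Fin 4`;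
* `exists_latticeIso_perm` — every `σ ∈ S₄` by a lattice isometry, exactly;
* `exists_latticeIso_sorting` — **covering lemma**: for every `ν` a lattice isometry `g` (with
  `g Λ₀ = Λ₀`) such that `⟪g h, ν⟫ ≤ 0` for the six heads.

WHAT THIS IS NOT: the film theorem (next file, with `…FourFamilyOrbit`); F-C1 not moved.
-/

noncomputable section

namespace Summit.Ventures.Crystal3D.Theorems

open Summit.Ventures.Crystal3D Finset
open Literature.MathematicalPhysics.StatisticalMechanics (barlowPos fccStacking barlowOffset layerNormal constHagg
  haggLabel_const barlowPos_apply_zero barlowPos_apply_one barlowPos_apply_two mem_barlowStacking_iff)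
open scoped InnerProductSpace

/-- **The transposition step**: for families `a ≠ b` a lattice isometry with
`R N_h = −N_(swap a b h)` for all four families. -/
theorem halfTurn_step (a b : Fin 4) (hab : a ≠ b) :
    ∃ R : EuclideanSpace ℝ (Fin 3) ≃ₗᵢ[ℝ] EuclideanSpace ℝ (Fin 3),
      (∀ p ∈ fccStacking 1 (Real.sqrt (2 / 3)), R p ∈ fccStacking 1 (Real.sqrt (2 / 3))) ∧
      (∀ p ∈ fccStacking 1 (Real.sqrt (2 / 3)), R.symm p ∈ fccStacking 1 (Real.sqrt (2 / 3))) ∧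
      ∀ h : Fin 4, R ((![((1 / 3 : ℝ) • barlowPos 1 (Real.sqrt (2 / 3)) constHagg 3 (-1) (-1)), ((1 / 3 : ℝ) • barlowPos 1 (Real.sqrt (2 / 3)) constHagg (-1) (-1) 3), ((1 / 3 : ℝ) • barlowPos 1 (Real.sqrt (2 / 3)) constHagg (-1) 3 (-1)), ((1 / 3 : ℝ) • barlowPos 1 (Real.sqrt (2 / 3)) constHagg (-1) (-1) (-1))] : Fin 4 → EuclideanSpace ℝ (Fin 3)) h) = -((![((1 / 3 : ℝ) • barlowPos 1 (Real.sqrt (2 / 3)) constHagg 3 (-1) (-1)), ((1 / 3 : ℝ) • barlowPos 1 (Real.sqrt (2 / 3)) constHagg (-1) (-1) 3), ((1 / 3 : ℝ) • barlowPos 1 (Real.sqrt (2 / 3)) constHagg (-1) 3 (-1)), ((1 / 3 : ℝ) • barlowPos 1 (Real.sqrt (2 / 3)) constHagg (-1) (-1) (-1))] : Fin 4 → EuclideanSpace ℝ (Fin 3)) (Equiv.swap a b h)) := by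
  fin_cases a <;> fin_cases b
  · exact absurd rfl hab
  · obtain ⟨R, h1, h2, e0, e1, e2, e3⟩ := halfTurn_step_01
    refine ⟨R, h1, h2, fun h => ?_⟩
    fin_cases h
    · simpa [Equiv.swap_apply_def] using e0
    · simpa [Equiv.swap_apply_def] using e1
    · simpa [Equiv.swap_apply_def] using e2
    · simpa [Equiv.swap_apply_def] using e3
  · obtain ⟨R, h1, h2, e0, e1, e2, e3⟩ := halfTurn_step_02
    refine ⟨R, h1, h2, fun h => ?_⟩
    fin_cases h
    · simpa [Equiv.swap_apply_def] using e0
    · simpa [Equiv.swap_apply_def] using e1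
    · simpa [Equiv.swap_apply_def] using e2
    · simpa [Equiv.swap_apply_def] using e3
  · obtain ⟨R, h1, h2, e0, e1, e2, e3⟩ := halfTurn_step_03
    refine ⟨R, h1, h2, fun h => ?_⟩
    fin_cases h
    · simpa [Equiv.swap_apply_def] using e0
    · simpa [Equiv.swap_apply_def] using e1
    · simpa [Equiv.swap_apply_def] using e2
    · simpa [Equiv.swap_apply_def] using e3
  · obtain ⟨R, h1, h2, e0, e1, e2, e3⟩ := halfTurn_step_01
    refine ⟨R, h1, h2, fun h => ?_⟩
    fin_cases h
    · simpa [Equiv.swap_apply_def] using e0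
    · simpa [Equiv.swap_apply_def] using e1
    · simpa [Equiv.swap_apply_def] using e2
    · simpa [Equiv.swap_apply_def] using e3
  · exact absurd rfl hab
  · obtain ⟨R, h1, h2, e0, e1, e2, e3⟩ := halfTurn_step_12
    refine ⟨R, h1, h2, fun h => ?_⟩
    fin_cases h
    · simpa [Equiv.swap_apply_def] using e0
    · simpa [Equiv.swap_apply_def] using e1
    · simpa [Equiv.swap_apply_def] using e2
    · simpa [Equiv.swap_apply_def] using e3
  · obtain ⟨R, h1, h2, e0, e1, e2, e3⟩ := halfTurn_step_13
    refine ⟨R, h1, h2, fun h => ?_⟩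
    fin_cases h
    · simpa [Equiv.swap_apply_def] using e0
    · simpa [Equiv.swap_apply_def] using e1
    · simpa [Equiv.swap_apply_def] using e2
    · simpa [Equiv.swap_apply_def] using e3
  · obtain ⟨R, h1, h2, e0, e1, e2, e3⟩ := halfTurn_step_02
    refine ⟨R, h1, h2, fun h => ?_⟩
    fin_cases h
    · simpa [Equiv.swap_apply_def] using e0
    · simpa [Equiv.swap_apply_def] using e1
    · simpa [Equiv.swap_apply_def] using e2
    · simpa [Equiv.swap_apply_def] using e3
  · obtain ⟨R, h1, h2, e0, e1, e2, e3⟩ := halfTurn_step_12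
    refine ⟨R, h1, h2, fun h => ?_⟩
    fin_cases h
    · simpa [Equiv.swap_apply_def] using e0
    · simpa [Equiv.swap_apply_def] using e1
    · simpa [Equiv.swap_apply_def] using e2
    · simpa [Equiv.swap_apply_def] using e3
  · exact absurd rfl hab
  · obtain ⟨R, h1, h2, e0, e1, e2, e3⟩ := halfTurn_step_23
    refine ⟨R, h1, h2, fun h => ?_⟩
    fin_cases h
    · simpa [Equiv.swap_apply_def] using e0
    · simpa [Equiv.swap_apply_def] using e1
    · simpa [Equiv.swap_apply_def] using e2
    · simpa [Equiv.swap_apply_def] using e3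
  · obtain ⟨R, h1, h2, e0, e1, e2, e3⟩ := halfTurn_step_03
    refine ⟨R, h1, h2, fun h => ?_⟩
    fin_cases h
    · simpa [Equiv.swap_apply_def] using e0
    · simpa [Equiv.swap_apply_def] using e1
    · simpa [Equiv.swap_apply_def] using e2
    · simpa [Equiv.swap_apply_def] using e3
  · obtain ⟨R, h1, h2, e0, e1, e2, e3⟩ := halfTurn_step_13
    refine ⟨R, h1, h2, fun h => ?_⟩
    fin_cases h
    · simpa [Equiv.swap_apply_def] using e0
    · simpa [Equiv.swap_apply_def] using e1
    · simpa [Equiv.swap_apply_def] using e2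
    · simpa [Equiv.swap_apply_def] using e3
  · obtain ⟨R, h1, h2, e0, e1, e2, e3⟩ := halfTurn_step_23
    refine ⟨R, h1, h2, fun h => ?_⟩
    fin_cases h
    · simpa [Equiv.swap_apply_def] using e0
    · simpa [Equiv.swap_apply_def] using e1
    · simpa [Equiv.swap_apply_def] using e2
    · simpa [Equiv.swap_apply_def] using e3
  · exact absurd rfl hab

/-- **Every permutation of the four families is realised by a lattice isometry.** -/
theorem exists_latticeIso_perm (σ : Equiv.Perm (Fin 4)) :
    ∃ g : EuclideanSpace ℝ (Fin 3) ≃ₗᵢ[ℝ] EuclideanSpace ℝ (Fin 3),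
      (∀ p ∈ fccStacking 1 (Real.sqrt (2 / 3)), g p ∈ fccStacking 1 (Real.sqrt (2 / 3))) ∧
      (∀ p ∈ fccStacking 1 (Real.sqrt (2 / 3)), g.symm p ∈ fccStacking 1 (Real.sqrt (2 / 3))) ∧
      ∀ h : Fin 4, g ((![((1 / 3 : ℝ) • barlowPos 1 (Real.sqrt (2 / 3)) constHagg 3 (-1) (-1)), ((1 / 3 : ℝ) • barlowPos 1 (Real.sqrt (2 / 3)) constHagg (-1) (-1) 3), ((1 / 3 : ℝ) • barlowPos 1 (Real.sqrt (2 / 3)) constHagg (-1) 3 (-1)), ((1 / 3 : ℝ) • barlowPos 1 (Real.sqrt (2 / 3)) constHagg (-1) (-1) (-1))] : Fin 4 → EuclideanSpace ℝ (Fin 3)) h) = (![((1 / 3 : ℝ) • barlowPos 1 (Real.sqrt (2 / 3)) constHagg 3 (-1) (-1)), ((1 / 3 : ℝ) • barlowPos 1 (Real.sqrt (2 / 3)) constHagg (-1) (-1) 3), ((1 / 3 : ℝ) • barlowPos 1 (Real.sqrt (2 / 3)) constHagg (-1) 3 (-1)), ((1 / 3 : ℝ) • barlowPos 1 (Real.sqrt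 (2 / 3)) constHagg (-1) (-1) (-1))] : Fin 4 → EuclideanSpace ℝ (Fin 3)) (σ h) := by
  have key : ∃ g : EuclideanSpace ℝ (Fin 3) ≃ₗᵢ[ℝ] EuclideanSpace ℝ (Fin 3), ∃ ε : ℝ, (ε = 1 ∨ ε = -1) ∧
      (∀ p ∈ fccStacking 1 (Real.sqrt (2 / 3)), g p ∈ fccStacking 1 (Real.sqrt (2 / 3))) ∧
      (∀ p ∈ fccStacking 1 (Real.sqrt (2 / 3)), g.symm p ∈ fccStacking 1 (Real.sqrt (2 / 3))) ∧
      ∀ h : Fin 4, g ((![((1 / 3 : ℝ) • barlowPos 1 (Real.sqrt (2 / 3)) constHagg 3 (-1) (-1)), ((1 / 3 : ℝ) • barlowPos 1 (Real.sqrt (2 / 3)) constHagg (-1) (-1) 3), ((1 / 3 : ℝ) • barlowPos 1 (Real.sqrt (2 / 3)) constHagg (-1) 3 (-1)), ((1 / 3 : ℝ) • barlowPos 1 (Real.sqrt (2 / 3)) constHagg (-1) (-1) (-1))] : Fin 4 → EuclideanSpace ℝ (Fin 3)) h) = ε • (![((1 / 3 : ℝ) • barlowPos 1 (Real.sqrt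 (2 / 3)) constHagg 3 (-1) (-1)), ((1 / 3 : ℝ) • barlowPos 1 (Real.sqrt (2 / 3)) constHagg (-1) (-1) 3), ((1 / 3 : ℝ) • barlowPos 1 (Real.sqrt (2 / 3)) constHagg (-1) 3 (-1)), ((1 / 3 : ℝ) • barlowPos 1 (Real.sqrt (2 / 3)) constHagg (-1) (-1) (-1))] : Fin 4 → EuclideanSpace ℝ (Fin 3)) (σ h) := by
    induction σ using Equiv.Perm.swap_induction_on with
    | one =>
      exact ⟨LinearIsometryEquiv.refl ℝ _, 1, Or.inl rfl, fun p hp => hp, fun p hp => hp,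
        fun h => by simp⟩
    | swap_mul f x y hxy ih =>
      obtain ⟨g, ε, hε, hg, hg', hN⟩ := ih
      obtain ⟨R, hR1, hR2, hRN⟩ := halfTurn_step x y hxy
      refine ⟨g.trans R, -ε, ?_, ?_, ?_, fun h => ?_⟩
      · rcases hε with rfl | rfl <;> simp
      · intro p hp
        rw [LinearIsometryEquiv.trans_apply]
        exact hR1 _ (hg p hp)
      · intro p hp
        rw [LinearIsometryEquiv.symm_trans, LinearIsometryEquiv.trans_apply]
        exact hg' _ (hR2 p hp)
      · rw [LinearIsometryEquiv.trans_apply, hN, map_smul, hRN, Equiv.Perm.mul_apply, smul_neg, neg_smul]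
  obtain ⟨g, ε, hε, hg, hg', hN⟩ := key
  rcases hε with rfl | rfl
  · exact ⟨g, hg, hg', fun h => by rw [hN, one_smul]⟩
  · refine ⟨g.trans (LinearIsometryEquiv.neg ℝ), ?_, ?_, fun h => ?_⟩
    · intro p hp
      rw [LinearIsometryEquiv.trans_apply, LinearIsometryEquiv.coe_neg]
      exact fcc_neg_mem (hg p hp)
    · intro p hp
      rw [LinearIsometryEquiv.symm_trans, LinearIsometryEquiv.trans_apply, LinearIsometryEquiv.symm_neg,
        LinearIsometryEquiv.coe_neg]
      exact hg' _ (fcc_neg_mem hp)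
    · rw [LinearIsometryEquiv.trans_apply, hN, LinearIsometryEquiv.coe_neg]
      simp

/-- **Covering lemma**: for every `ν` there is a lattice isometry `g` with `⟪g h, ν⟫ ≤ 0` for the six
heads of the fundamental cone (sort the four family components of `ν`). -/
theorem exists_latticeIso_sorting (ν : EuclideanSpace ℝ (Fin 3)) :
    ∃ g : EuclideanSpace ℝ (Fin 3) ≃ₗᵢ[ℝ] EuclideanSpace ℝ (Fin 3),
      (∀ p ∈ fccStacking 1 (Real.sqrt (2 / 3)), g p ∈ fccStacking 1 (Real.sqrt (2 / 3))) ∧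
      (∀ p ∈ fccStacking 1 (Real.sqrt (2 / 3)), g.symm p ∈ fccStacking 1 (Real.sqrt (2 / 3))) ∧
      ∀ e ∈ ([barlowPos 1 (Real.sqrt (2 / 3)) constHagg 0 1 (-1), -barlowPos 1 (Real.sqrt (2 / 3)) constHagg 1 0 0, -barlowPos 1 (Real.sqrt (2 / 3)) constHagg 0 1 0,
      barlowPos 1 (Real.sqrt (2 / 3)) constHagg (-1) 0 1, -barlowPos 1 (Real.sqrt (2 / 3)) constHagg 0 0 1, barlowPos 1 (Real.sqrt (2 / 3)) constHagg (-1) 1 0] : List (EuclideanSpace ℝ (Fin 3))), ⟪g e, ν⟫_ℝ ≤ 0 := by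
  obtain ⟨g, hg, hg', hN⟩ := exists_latticeIso_perm (Tuple.sort (fun f : Fin 4 => -⟪(![((1 / 3 : ℝ) • barlowPos 1 (Real.sqrt (2 / 3)) constHagg 3 (-1) (-1)), ((1 / 3 : ℝ) • barlowPos 1 (Real.sqrt (2 / 3)) constHagg (-1) (-1) 3), ((1 / 3 : ℝ) • barlowPos 1 (Real.sqrt (2 / 3)) constHagg (-1) 3 (-1)), ((1 / 3 : ℝ) • barlowPos 1 (Real.sqrt (2 / 3)) constHagg (-1) (-1) (-1))] : Fin 4 → EuclideanSpace ℝ (Fin 3)) f, ν⟫_ℝ))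
  have hmono := Tuple.monotone_sort (fun f : Fin 4 => -⟪(![((1 / 3 : ℝ) • barlowPos 1 (Real.sqrt (2 / 3)) constHagg 3 (-1) (-1)), ((1 / 3 : ℝ) • barlowPos 1 (Real.sqrt (2 / 3)) constHagg (-1) (-1) 3), ((1 / 3 : ℝ) • barlowPos 1 (Real.sqrt (2 / 3)) constHagg (-1) 3 (-1)), ((1 / 3 : ℝ) • barlowPos 1 (Real.sqrt (2 / 3)) constHagg (-1) (-1) (-1))] : Fin 4 → EuclideanSpace ℝ (Fin 3)) f, ν⟫_ℝ)
  refine ⟨g, hg, hg', ?_⟩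
  have heads : ∀ e ∈ ([barlowPos 1 (Real.sqrt (2 / 3)) constHagg 0 1 (-1), -barlowPos 1 (Real.sqrt (2 / 3)) constHagg 1 0 0, -barlowPos 1 (Real.sqrt (2 / 3)) constHagg 0 1 0,
      barlowPos 1 (Real.sqrt (2 / 3)) constHagg (-1) 0 1, -barlowPos 1 (Real.sqrt (2 / 3)) constHagg 0 0 1, barlowPos 1 (Real.sqrt (2 / 3)) constHagg (-1) 1 0] : List (EuclideanSpace ℝ (Fin 3))),
      ∃ a b : Fin 4, a < b ∧ e = (3 / 4 : ℝ) • ((![((1 / 3 : ℝ) • barlowPos 1 (Real.sqrt (2 / 3)) constHagg 3 (-1) (-1)), ((1 / 3 : ℝ) • barlowPos 1 (Real.sqrt (2 / 3)) constHagg (-1) (-1) 3), ((1 / 3 : ℝ) • barlowPos 1 (Real.sqrt (2 / 3)) constHagg (-1) 3 (-1)), ((1 / 3 : ℝ) • barlowPos 1 (Real.sqrt (2 / 3)) constHagg (-1) (-1) (-1))] : Fin 4 → EuclideanSpace ℝ (Fin 3)) b - (![((1 / 3 : ℝ) • barlowPos 1 (Real.sqrt (2 / 3)) constHagg 3 (-1)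 (-1)), ((1 / 3 : ℝ) • barlowPos 1 (Real.sqrt (2 / 3)) constHagg (-1) (-1) 3), ((1 / 3 : ℝ) • barlowPos 1 (Real.sqrt (2 / 3)) constHagg (-1) 3 (-1)), ((1 / 3 : ℝ) • barlowPos 1 (Real.sqrt (2 / 3)) constHagg (-1) (-1) (-1))] : Fin 4 → EuclideanSpace ℝ (Fin 3)) a) := by
    intro e he
    simp only [List.mem_cons, List.mem_nil_iff, or_false] at he
    rcases he with rfl | rfl | rfl | rfl | rfl | rfl
    · refine ⟨1, 2, by decide, ?_⟩
      simp only [Fin.isValue, Matrix.cons_val]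
      rw [show (barlowPos 1 (Real.sqrt (2 / 3)) constHagg 0 1 (-1) : EuclideanSpace ℝ (Fin 3)) = -barlowPos 1 (Real.sqrt (2 / 3)) constHagg 0 (-1) 1 by rw [← barlowPos_fcc_neg 0 (-1) 1]; simp only [neg_zero, neg_neg]]
      exact head_combo 0 (-1) 1 (-1) (-1) 3 (-1) 3 (-1) (by norm_num) (by norm_num) (by norm_num)
    · refine ⟨0, 3, by decide, ?_⟩
      simp only [Fin.isValue, Matrix.cons_val]
      exact head_combo 1 0 0 3 (-1) (-1) (-1) (-1) (-1) (by norm_num) (by norm_num) (by norm_num)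
    · refine ⟨2, 3, by decide, ?_⟩
      simp only [Fin.isValue, Matrix.cons_val]
      exact head_combo 0 1 0 (-1) 3 (-1) (-1) (-1) (-1) (by norm_num) (by norm_num) (by norm_num)
    · refine ⟨0, 1, by decide, ?_⟩
      simp only [Fin.isValue, Matrix.cons_val]
      rw [show (barlowPos 1 (Real.sqrt (2 / 3)) constHagg (-1) 0 1 : EuclideanSpace ℝ (Fin 3)) = -barlowPos 1 (Real.sqrt (2 / 3)) constHagg 1 0 (-1) by rw [← barlowPos_fcc_neg 1 0 (-1)]; simp only [neg_zero, neg_neg]]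
      exact head_combo 1 0 (-1) 3 (-1) (-1) (-1) (-1) 3 (by norm_num) (by norm_num) (by norm_num)
    · refine ⟨1, 3, by decide, ?_⟩
      simp only [Fin.isValue, Matrix.cons_val]
      exact head_combo 0 0 1 (-1) (-1) 3 (-1) (-1) (-1) (by norm_num) (by norm_num) (by norm_num)
    · refine ⟨0, 2, by decide, ?_⟩
      simp only [Fin.isValue, Matrix.cons_val]
      rw [show (barlowPos 1 (Real.sqrt (2 / 3)) constHagg (-1) 1 0 : EuclideanSpace ℝ (Fin 3)) = -barlowPos 1 (Real.sqrt (2 / 3)) constHagg 1 (-1) 0 by rw [← barlowPos_fcc_neg 1 (-1) 0]; simp only [neg_zero, neg_neg]]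
      exact head_combo 1 (-1) 0 3 (-1) (-1) (-1) 3 (-1) (by norm_num) (by norm_num) (by norm_num)
  intro e he
  obtain ⟨a, b, hab, rfl⟩ := heads e he
  rw [map_smul, map_sub, hN, hN, real_inner_smul_left, inner_sub_left]
  have hle := hmono hab.le
  simp only [Function.comp] at hle
  linarith

end Summit.Ventures.Crystal3D.Theorems

end
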